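import Mathlib.MeasureTheory.Integral.Bochner.Basic
import Mathlib.Algebra.Order.BigOperators.Ring.Finset
import Mathlib.Algebra.BigOperators.Ring.Finset
import Mathlib.Algebra.BigOperators.Intervals
import Mathlib.Algebra.Ring.GeomSum
import Mathlib.Logic.Function.DependsOn
import Literature.ComputerArithmetic.ElararEtAl2026.HornerPairwiseProof
import HarnessLib

/-!
# El Arar–Fasi–Filip–Mikaitis 2025, §3–§4: the probabilistic error analysis of limited-precision
# stochastic rounding `SR_{p,r}` — Lemma 3, Theorem 1, Lemmas 4–5 and Theorems 2–7 PROVED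

HONEST FRAMING: shared numerical engines serving client cells; rigour lives in the verifiers; every
published number belongs to a client cell's ledger, not to the engines group.

Source: E.-M. El Arar, M. Fasi, S.-I. Filip, M. Mikaitis, *Probabilistic error analysis of
limited-precision stochastic rounding*, SIAM J. Sci. Comput. 47(5) (2025) B1227–B1249,
doi:10.1137/24m1681458 = arXiv:2408.03069 [cite: ElararEtAl2025]. Numbering and page pointers are
those of the arXiv text (as in the companion fact file `ElararEtAl2025.LimitedPrecisionSR`, whose
docstring lists exactly the results below as "NOT typed here"); proofs read from §3 (Lemma 3 with its
proof, Remarks 4–6, eq. (3.3), Theorem 1 with its proof, Lemma 4, Lemma 5 with its proof, eqs.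
(3.8)–(3.9)) and §4 (eqs. (4.4)–(4.5), Theorems 2–4 with their proofs, eqs. (4.8)–(4.9); the
recurrence table and closed form of §4.2, Theorems 5–7). Equation numbers are counted in the arXiv
text; theorem / lemma / remark numbers are the arXiv ones (SISC numbers its results by section).

**The model (Lemma 3 as the standing hypothesis).** In the source the rounding errors `δ_1, δ_2, …`
of a chain of elementary operations under `SR_{p,r}` and the corresponding DETERMINISTIC relative
errors `β_k` of the truncation `tr_{p+r}` applied to the same exact intermediate result satisfy:
`|δ_k| ≤ u_p` (eq. (2.2), §4.1), `|β_k| ≤ u_{p+r}` (§2.3), `β_k` is a function of `δ_1, …, δ_{k−1}`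
(Remark 5; proof of Lemma 5: "`β_k` is entirely determined by `δ_1, …, δ_{k−1}`"),
`|δ_k − β_k| ≤ u_p` (proof of Theorem 3: "the `α_{k−1}` are … bound in magnitude by `u_p`"; indeed
`SR_{p,r}(c)` and `tr_{p+r}(c)` both lie in `[⌊c⌋_p, ⌈c⌉_p]`, of width `≤ |c|u_p`), and
**LEMMA 3**: `E(δ_k | δ_1, …, δ_{k−1}) = β_k`. Exactly as `ConnollyHighamMary2021.SRErrorModel`
types `E(δ_k | δ_1, …, δ_{k−1}) = 0` in test-function form, `SRprErrorModel μ u_p u_{p+r} δ β` types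
Lemma 3 as `E[g(δ_0, …, δ_{k−1}) δ_k] = E[g(δ_0, …, δ_{k−1}) β_k]` for every bounded measurable `g`
(indices from `0`; a `k = 0` error is allowed and harmless). In the source these properties are
DERIVED from Definition 4 of `SR_{p,r}`; here they are the standing hypotheses, and the per-operation
identities behind them (`E(SR_{p,r}(x)) = tr_{p+r}(x)`, the variance bound) are the PROVED
`limMean_eq`, `limVar_le` of the fact file.

**What is proved.**
* Remark 5 / eq. (3.3) `E(β_k) = E(δ_k)` (`integral_eq_integral_bias`); Remark 4 (`u_{p+r} = 0`:
  the `δ_k` are mean independent, `SR_{p,r} = SR_p`: `srErrorModel_of_upr_zero`, `of_srErrorModel`).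
* **LEMMA 5** (`SRprErrorModel.limited`): the `α_k = δ_k − β_k` are mean independent with mean zero
  and `|α_k| ≤ u_p`, i.e. `(α, β)` is an `ElararEtAl2026.LimitedSRErrorModel μ u_p u_{p+r} α β` — the
  model over which the tree PROVED the 2026 sequel's Theorems 1–2 (`HornerPairwiseProof`); its
  second half, eqs. (3.8)–(3.9) `∏(1+δ_k) = ∏(1+α_k) + B`, `|B| ≤ γ_m(u_p+u_{p+r}) − γ_m(u_p)`, is
  the tree's `ElararEtAl2026.abs_prod_sub_prod_le` (= Lemma 1 of the sequel), restated here as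
  `SRprErrorModel.abs_prod_sub_prod_le`; **LEMMA 4** (power-set expansion) is `prod_add_eq`.
* **THEOREM 1** `E ∏_{k∈K}(1+δ_k) ≤ (1+u_{p+r})^{|K|}` for every finite set `K` of error indices
  (`integral_prod_le`, by the source's induction on `max K`: `E[Q(1+δ_m)] = E[Q] + E[Qβ_m]`,
  `integral_prod_insert`), in the floating-point regime `u_p ≤ 1` (which makes `Q ≥ 0`, used
  silently by the source); together with the lower bound `(1−u_{p+r})^{|K|} ≤ E∏` (`le_integral_prod`,
  `u_{p+r} ≤ 1`) that the absolute values in Theorems 2 and 5 require: `|E∏ − 1| ≤ γ_{|K|}(u_{p+r})`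
  (`abs_integral_prod_sub_one_le`).
* The mechanism of §4 for a general "recursive sum" `Σ_{i∈I} cᵢ ∏_{k∈Kᵢ}(1+δ_k)`, `|Kᵢ| ≤ N`:
  bias `|E Σcᵢ∏ − Σcᵢ| ≤ (Σ|cᵢ|) γ_N(u_{p+r})` (`abs_integral_err_le`), and eq. (4.8)
  "`|ŷ − y| ≤ |M| + |A|`": a tail bound for the error under the mean-independent part `α` transfers to
  `δ` at the cost `(Σ|cᵢ|)(γ_N(u_p+u_{p+r}) − γ_N(u_p))` (`tail_le_of_split`, from the sequel's PROVED
  `ElararEtAl2026.measure_err_gt_le_of_split`).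
* §4.1 recursive summation, eq. (4.4) `ŷ = Σ_{i=1}^{n} aᵢ ∏_{k=max(i,2)}^{n} (1+δ_{k−1})`
  (`sumComputed`): **THEOREM 2** (bias `≤ (Σ|aᵢ|) γ_{n−1}(u_{p+r})`, `sum_bias_le`), **THEOREM 3**
  (Azuma–Hoeffding: `|ŷ − y| ≤ (Σ|aᵢ|)(√(u_pγ_{2(n−1)}(u_p))√(ln(2/λ)) + γ_{n−1}(u_p+u_{p+r}) −
  γ_{n−1}(u_p))` with probability at least `1 − λ`, `sum_bound_AH`, the martingale part being the
  tree's PROVED `ElararEtAl2023.measure_err_gt_le_AH` = [esop23a, Thm. 4.5]'s argument), **THEOREM 4**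
  (Bienaymé–Chebyshev: radius `√(γ_{n−1}(u_p²)/λ)`, `sum_bound_BC`, via `measure_err_gt_le_BC`).
* §4.2 inner products, the recurrence `ŝ_{2k−1} = ŝ_{2k−2} + aₖbₖ(1+δ_{2k−2})`,
  `ŝ_{2k} = ŝ_{2k−1}(1+δ_{2k−1})` (`δ_0 = 0`), i.e. `ŷ = Σ aᵢbᵢ(1+δ_{2i−2})∏_{k=i}^{n}(1+δ_{2k−1})` —
  this is [esop23a]'s inner product, the tree's `ElararEtAl2023.ipComputed` (the closed form printed
  after the table interchanges the labels `2i−1 ↔ 2(k−1)` relative to the recurrence table above it; we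
  follow the recurrence): **THEOREM 5** (bias `≤ (Σ|aᵢbᵢ|) γ_n(u_{p+r})`, `ip_bias_le`), **THEOREM 6**
  (radius `√(u_pγ_{2n}(u_p))√(ln(2/λ)) + γ_n(u_p+u_{p+r}) − γ_n(u_p)`, `ip_bound_AH`), **THEOREM 7**
  (radius `√(γ_n(u_p²)/λ) + …`, `ip_bound_BC`). For Theorem 6 the printed `γ_{2n}` needs sharper
  increment bounds than the generic `(Σ|cᵢ|)(1+u)^{t−1}` of [esop23a, Thm. 4.5] (which would give
  `γ_{2(2n−1)}`): at the addition time `2k−1` the coefficient is bounded by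
  `(Σ_{i≤k}|cᵢ|)(1+u_p)^{k−1}` and at the multiplication time `2k−2` by `|cₖ|` (`ipBound`,
  `abs_ahCoef_ip_le`), whence `2Σ_t(A_tu_p)² ≤ (Σ|cᵢ|)² u_pγ_{2n}(u_p)` (`two_mul_sum_ipBound_sq_le`) and
  Azuma–Hoeffding (`HallmanIpsen2023.azumaHoeffding`) gives `ip_measure_err_gt_le_AH`.

The source states Theorems 3, 4, 6, 7 with the relative error (dividing by `|y|` and writing the
condition number `κ = Σ|aᵢ|/|Σaᵢ|`); we state them multiplied through by `|y|`, as the tree does for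
[esop23a] and the sequel. No hypothesis `λ < 1`, `u_{p+r} ≤ u_p` or `u_p < 1` is needed beyond what
is stated (`u_p ≤ 1`, `u_{p+r} ≤ 1` for the bias bounds; nothing for the tail bounds).
-/

namespace Literature.ComputerArithmetic.ElararEtAl2025

open _root_.MeasureTheory
open Finset
open Literature.ComputerArithmetic.ConnollyHighamMary2021 (SRErrorModel gammaSq)
open Literature.ComputerArithmetic.ElararEtAl2023 (ahCoef isPredictable_ahCoef measure_err_gt_le_AH
  measure_err_gt_le_BC ipComputed ipIndex ipComputed_eq_sum_prod card_ipIndex_le)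
open Literature.ComputerArithmetic.ElararEtAl2026 (gammaFn LimitedSRErrorModel)
open Literature.ComputerArithmetic.HallmanIpsen2023 (clip transform azumaRadius azumaHoeffding
  u_nonneg)

/-! ### Lemma 4: the power-set expansion of a product of binomials -/

/-- **LEMMA 4.** For a finite index set `I` and reals `x_k, y_k`,
`∏_{k∈I}(x_k + y_k) = ∏_{k∈I} x_k + Σ_{K ⊊ I} (∏_{i∈K} x_i)(∏_{j∈I∖K} y_j)` (the full expansion over
the power set, `Finset.prod_add`, with the term `K = I` extracted).
[cite: ElararEtAl2025, §3 Lemma 4, eq. (3.6) (proof: eq. (3.7) by induction, from the power-set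
recursion (3.5))] -/
theorem prod_add_eq {ι : Type*} [DecidableEq ι] (I : Finset ι) (x y : ι → ℝ) :
    ∏ k ∈ I, (x k + y k)
      = ∏ k ∈ I, x k + ∑ K ∈ I.powerset with K ≠ I, (∏ i ∈ K, x i) * ∏ j ∈ I \ K, y j := by
  have hfilt : I.powerset.filter (fun K => K ≠ I) = I.powerset.erase I := by
    ext K
    simp only [Finset.mem_filter, Finset.mem_erase]
    exact and_comm
  rw [hfilt, Finset.prod_add, ← Finset.sum_erase_add _ _ (Finset.mem_powerset_self I),
    Finset.sdiff_self, Finset.prod_empty, mul_one, add_comm]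

/-! ### The model: Lemma 3 and the bounds of §2 as standing hypotheses -/

/-- The **limited-precision SR error model of §3**, indexed from `0`: the rounding errors `δ_k` of a
chain of operations under `SR_{p,r}` and the truncation errors `β_k` (`tr_{p+r}(c) = c(1+β_k)` for the
exact result `c` of the `k`-th operation) are real random variables on a probability space with
`δ_k` measurable and `|δ_k| ≤ u_p` (eq. (2.2); §4.1 "`|δ_{k−1}| ≤ u_p`"), `|β_k| ≤ u_{p+r}` (§2.3),
`|δ_k − β_k| ≤ u_p` (Thm. 3 proof: the `α_k = δ_k − β_k` "are bound in magnitude by `u_p`"), `β_k` a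
measurable function of `δ_0, …, δ_{k−1}` (Remark 5, Lemma 5 proof), and **LEMMA 3**,
`E(δ_k | δ_0, …, δ_{k−1}) = β_k`, in test-function form: `E[g(δ_0,…,δ_{k−1}) δ_k] =
E[g(δ_0,…,δ_{k−1}) β_k]` for every bounded measurable `g`.
[cite: ElararEtAl2025, §3 Lemma 3; Remark 5; §2.2 eq. (2.2); §2.3 (`|β| ≤ u_{p+r}`)] -/
structure SRprErrorModel {Ω : Type*} [MeasurableSpace Ω] (μ : Measure Ω) (up upr : ℝ)
    (δ β : ℕ → Ω → ℝ) : Prop where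
  measurable : ∀ k, Measurable (δ k)
  bounded : ∀ k ω, |δ k ω| ≤ up
  biasBounded : ∀ k ω, |β k ω| ≤ upr
  gapBounded : ∀ k ω, |δ k ω - β k ω| ≤ up
  predictable : ∀ k, ∃ b : (Fin k → ℝ) → ℝ, Measurable b ∧ ∀ ω, β k ω = b (fun i => δ i ω)
  condMean : ∀ (k : ℕ) (g : (Fin k → ℝ) → ℝ), Measurable g → (∃ C, ∀ v, |g v| ≤ C) →
    ∫ ω, g (fun i => δ i ω) * δ k ω ∂μ = ∫ ω, g (fun i => δ i ω) * β k ω ∂μ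

section General

variable {Ω : Type*} [MeasurableSpace Ω] {μ : Measure Ω} {up upr : ℝ} {δ β : ℕ → Ω → ℝ}

namespace SRprErrorModel

/-- The truncation errors are random variables ("`β_k` is a random variable despite having been
produced by a deterministic rounding mode"). [cite: ElararEtAl2025, §3 Remark 5] -/
theorem biasMeasurable (h : SRprErrorModel μ up upr δ β) (k : ℕ) : Measurable (β k) := by
  obtain ⟨b, hb, hbβ⟩ := h.predictable k
  have : β k = fun ω => b (fun i => δ i ω) := funext hbβ
  rw [this]
  exact hb.comp (measurable_pi_lambda _ (fun i => h.measurable i))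

/-- `0 ≤ u_p` on a probability space. [cite: ElararEtAl2025, §2.2 eq. (2.2)] -/
theorem up_nonneg [IsProbabilityMeasure μ] (h : SRprErrorModel μ up upr δ β) : 0 ≤ up := by
  obtain ⟨ω⟩ := nonempty_of_isProbabilityMeasure μ
  exact (abs_nonneg _).trans (h.bounded 0 ω)

/-- `0 ≤ u_{p+r}` on a probability space. [cite: ElararEtAl2025, §2.3 (`|β| ≤ u_{p+r}`)] -/
theorem upr_nonneg [IsProbabilityMeasure μ] (h : SRprErrorModel μ up upr δ β) : 0 ≤ upr := by
  obtain ⟨ω⟩ := nonempty_of_isProbabilityMeasure μ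
  exact (abs_nonneg _).trans (h.biasBounded 0 ω)

/-- [folklore] a measurable function with a sure bound is integrable on a finite measure space. -/
private theorem integrable_of_abs_le [IsFiniteMeasure μ] {f : Ω → ℝ} (hf : Measurable f) {C : ℝ}
    (hC : ∀ ω, |f ω| ≤ C) : Integrable f μ :=
  Integrable.of_mem_Icc (-C) C hf.aemeasurable (ae_of_all _ fun ω => abs_le.mp (hC ω))

/-- [folklore] measurability of `∏_{k∈K}(1 + δ_k)`. -/
private theorem measurable_prod (h : SRprErrorModel μ up upr δ β) (K : Finset ℕ) :
    Measurable (fun ω => ∏ k ∈ K, (1 + δ k ω)) :=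
  Finset.measurable_prod K (fun k _ => (h.measurable k).const_add 1)

/-- [folklore] `|∏_{k∈K}(1 + δ_k)| ≤ (1 + u_p)^{|K|}`. -/
private theorem abs_prod_le (h : SRprErrorModel μ up upr δ β) (K : Finset ℕ) (ω : Ω) :
    |∏ k ∈ K, (1 + δ k ω)| ≤ (1 + up) ^ K.card := by
  rw [Finset.abs_prod]
  calc ∏ k ∈ K, |1 + δ k ω| ≤ ∏ _k ∈ K, (1 + up) :=
        Finset.prod_le_prod (fun _ _ => abs_nonneg _) (fun k _ =>
          (abs_add_le 1 (δ k ω)).trans (by rw [abs_one]; linarith [h.bounded k ω]))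
    _ = (1 + up) ^ K.card := Finset.prod_const _

/-- [folklore] in the floating-point regime `u_p ≤ 1`, `∏_{k∈K}(1 + δ_k) ≥ 0`. -/
private theorem prod_nonneg_of_le_one (h : SRprErrorModel μ up upr δ β) (hup1 : up ≤ 1)
    (K : Finset ℕ) (ω : Ω) : 0 ≤ ∏ k ∈ K, (1 + δ k ω) :=
  Finset.prod_nonneg (fun k _ => by have := abs_le.mp (h.bounded k ω); linarith)

/-- [folklore] integrability of `∏_{k∈K}(1 + δ_k)`. -/
private theorem integrable_prod [IsFiniteMeasure μ] (h : SRprErrorModel μ up upr δ β)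
    (K : Finset ℕ) : Integrable (fun ω => ∏ k ∈ K, (1 + δ k ω)) μ :=
  integrable_of_abs_le (measurable_prod h K) (abs_prod_le h K)

/-- **Lemma 3 for functionals of the whole past sequence (cube version).** For a measurable `F` on
sequences depending only on the coordinates `< m` and bounded on the cube `{v | ∀ j, |v j| ≤ u_p}`,
`E[F(δ) δ_m] = E[F(δ) β_m]` (clip the coordinates into `[−u_p, u_p]`, extend the prefix by zero, and
apply the model's clause). [cite: ElararEtAl2025, §3 Lemma 3 (`E(δ_k | δ_1,…,δ_{k−1}) = β_k`)] -/
theorem integral_pastFn_mul_eq (h : SRprErrorModel μ up upr δ β) (hup : 0 ≤ up) (m : ℕ)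
    {F : (ℕ → ℝ) → ℝ} (hF : Measurable F) (hdep : DependsOn F (Set.Iio m))
    (hbd : ∃ C, ∀ v : ℕ → ℝ, (∀ j, |v j| ≤ up) → |F v| ≤ C) :
    ∫ ω, F (fun i => δ i ω) * δ m ω ∂μ = ∫ ω, F (fun i => δ i ω) * β m ω ∂μ := by
  have hclip_le : ∀ t, |clip up t| ≤ up := fun t =>
    abs_le.mpr ⟨le_max_left _ _, max_le (by linarith) (min_le_right _ _)⟩
  have hclip_id : ∀ t, |t| ≤ up → clip up t = t := fun t ht => by
    rw [abs_le] at ht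
    unfold clip
    rw [min_eq_left ht.2, max_eq_right ht.1]
  have hclip_meas : Measurable (clip up) := by
    unfold clip; exact measurable_const.max (measurable_id.min measurable_const)
  -- the prefix, extended by zero and clipped into the cube
  set ext : (Fin m → ℝ) → (ℕ → ℝ) :=
    fun w j => clip up (if hj : j < m then w ⟨j, hj⟩ else 0) with hext
  have hextm : Measurable ext := by
    refine measurable_pi_lambda _ (fun j => hclip_meas.comp ?_)
    by_cases hj : j < m
    · simp only [hj, dite_true]; exact measurable_pi_apply _
    · simp only [hj, dite_false]; exact measurable_const
  set g : (Fin m → ℝ) → ℝ := fun w => F (ext w) with hg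
  have hgm : Measurable g := hF.comp hextm
  have hgb : ∃ C, ∀ w, |g w| ≤ C := by
    obtain ⟨C, hC⟩ := hbd
    exact ⟨C, fun w => hC _ (fun j => hclip_le _)⟩
  have key := h.condMean m g hgm hgb
  have hgδ : ∀ ω, g (fun i : Fin m => δ i ω) = F (fun i => δ i ω) := by
    intro ω
    refine hdep (fun j hj => ?_)
    simp only [Set.mem_Iio] at hj
    simp only [hext, hj, dite_true]
    exact hclip_id _ (h.bounded j ω)
  simp_rw [hgδ] at key
  exact key

/-- **Remark 5, eq. (3.3):** `E(β_k) = E(E(δ_k | δ_1,…,δ_{k−1})) = E(δ_k)` — the rounding error of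
an operation and the truncation error applied for this operation have the same expected value
(Remark 6). [cite: ElararEtAl2025, §3 Remark 5 eq. (3.3); Remark 6] -/
theorem integral_eq_integral_bias (h : SRprErrorModel μ up upr δ β) (k : ℕ) :
    ∫ ω, δ k ω ∂μ = ∫ ω, β k ω ∂μ := by
  have key := h.condMean k (fun _ => 1) measurable_const ⟨1, fun _ => by simp⟩
  simpa only [one_mul] using key

/-- **Remark 4:** with `u_{p+r} = 0` ("a large number of random bits `r`") the `β_k` vanish and the
`δ_k` satisfy the mean independence property — the model is then the exact-SR model
`ConnollyHighamMary2021.SRErrorModel` ("`SR_{p,r}` coincides with `SR_p`").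
[cite: ElararEtAl2025, §3 Remark 4] -/
theorem srErrorModel_of_upr_zero (h : SRprErrorModel μ up 0 δ β) : SRErrorModel μ up δ where
  measurable := h.measurable
  bounded := h.bounded
  meanIndep := by
    intro k g hg hgb
    have hβ : ∀ ω, β k ω = 0 := fun ω => abs_nonpos_iff.mp (h.biasBounded k ω)
    have key := h.condMean k g hg hgb
    simp_rw [hβ, mul_zero, integral_zero] at key
    exact key

/-- Conversely (Remark 4, sanity of the typing): an exact-SR error sequence is a limited-precision one
with `β ≡ 0`, `u_{p+r} = 0`. [cite: ElararEtAl2025, §3 Remark 4] -/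
theorem of_srErrorModel {u : ℝ} {δ : ℕ → Ω → ℝ} (h : SRErrorModel μ u δ) :
    SRprErrorModel μ u 0 δ (fun _ _ => 0) where
  measurable := h.measurable
  bounded := h.bounded
  biasBounded := fun _ _ => by simp
  gapBounded := fun k ω => by simpa using h.bounded k ω
  predictable := fun k => ⟨fun _ => 0, measurable_const, fun _ => rfl⟩
  condMean := by
    intro k g hg hgb
    rw [h.meanIndep k g hg hgb]
    simp

/-- **LEMMA 5 (the general model), first part:** the random variables `α_k = δ_k − β_k` are mean
independent with mean zero, `E(α_k | α_1,…,α_{k−1}) = E(α_k) = 0`, measurable and bounded by `u_p`;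
with the measurable truncation errors `|β_k| ≤ u_{p+r}` this is precisely the tree's
`ElararEtAl2026.LimitedSRErrorModel μ u_p u_{p+r} α β` (`δ_k = α_k + β_k`). Proof as in the source:
a bounded measurable test function of `α_0,…,α_{k−1}` is one of `δ_0,…,δ_{k−1}` (the `β_i` being
functions of the past `δ`'s), and `E[g δ_k] − E[g β_k] = 0` by Lemma 3.
[cite: ElararEtAl2025, §3 Lemma 5 (first display) and its proof] -/
theorem limited [IsFiniteMeasure μ] (h : SRprErrorModel μ up upr δ β) :
    LimitedSRErrorModel μ up upr (fun k ω => δ k ω - β k ω) β where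
  meanIndep :=
    { measurable := fun k => (h.measurable k).sub (h.biasMeasurable k)
      bounded := h.gapBounded
      meanIndep := by
        intro k g hg hgb
        choose b hbm hb using h.predictable
        -- the test function of the `α`-prefix as a function of the `δ`-prefix
        set g' : (Fin k → ℝ) → ℝ :=
          fun v => g (fun i => v i - b i (fun j => v ⟨j, lt_trans j.2 i.2⟩)) with hg'
        have hg'm : Measurable g' :=
          hg.comp (measurable_pi_lambda _ (fun i => (measurable_pi_apply i).sub
            ((hbm i).comp (measurable_pi_lambda _ (fun j => measurable_pi_apply _)))))
        obtain ⟨C, hC⟩ := hgb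
        have hg'b : ∃ C, ∀ v, |g' v| ≤ C := ⟨C, fun v => hC _⟩
        have hgg' : ∀ ω, g (fun i : Fin k => δ i ω - β i ω) = g' (fun i : Fin k => δ i ω) := by
          intro ω
          simp only [hg', hb]
        have key := h.condMean k g' hg'm hg'b
        have hGm : Measurable (fun ω => g' (fun i : Fin k => δ i ω)) :=
          hg'm.comp (measurable_pi_lambda _ (fun i => h.measurable i))
        have hGi : Integrable (fun ω => g' (fun i : Fin k => δ i ω)) μ :=
          integrable_of_abs_le hGm (fun ω => hC _)
        have hi1 : Integrable (fun ω => g' (fun i : Fin k => δ i ω) * δ k ω) μ :=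
          hGi.mul_bdd (c := up) (h.measurable k).aestronglyMeasurable
            (ae_of_all _ (fun ω => by rw [Real.norm_eq_abs]; exact h.bounded k ω))
        have hi2 : Integrable (fun ω => g' (fun i : Fin k => δ i ω) * β k ω) μ :=
          hGi.mul_bdd (c := upr) (h.biasMeasurable k).aestronglyMeasurable
            (ae_of_all _ (fun ω => by rw [Real.norm_eq_abs]; exact h.biasBounded k ω))
        simp_rw [hgg', mul_sub]
        rw [integral_sub hi1 hi2, key, sub_self] }
  biasMeasurable := h.biasMeasurable
  biasBounded := h.biasBounded

/-- **LEMMA 5, second part, eqs. (3.8)–(3.9), pathwise:** for every finite set `K` of error indices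
and every outcome, `|∏_{k∈K}(1+δ_k) − ∏_{k∈K}(1+α_k)| ≤ γ_{|K|}(u_p+u_{p+r}) − γ_{|K|}(u_p)`
(`γ_m(x) = (1+x)^m − 1`) — the tree's PROVED `ElararEtAl2026.abs_prod_sub_prod_le` (Lemma 1 of the
2026 sequel is this Lemma 5). [cite: ElararEtAl2025, §3 Lemma 5 eqs. (3.8)–(3.9)] -/
theorem abs_prod_sub_prod_le [IsProbabilityMeasure μ] (h : SRprErrorModel μ up upr δ β)
    (K : Finset ℕ) (ω : Ω) :
    |(∏ k ∈ K, (1 + δ k ω)) - ∏ k ∈ K, (1 + (δ k ω - β k ω))|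
      ≤ gammaFn K.card (up + upr) - gammaFn K.card up := by
  have key := h.limited.abs_prod_sub_prod_le h.up_nonneg K ω
  simpa only [sub_add_cancel] using key

/-! ### Theorem 1: `E ∏(1+δ_k) ≤ (1+u_{p+r})^n` -/

/-- **The inductive step of Theorem 1:** if every index of `s` is below `m` then
`E[∏_{k∈s∪{m}}(1+δ_k)] = E[∏_{k∈s}(1+δ_k)] + E[(∏_{k∈s}(1+δ_k)) β_m]` — the law of total
expectation and Lemma 3, `E(Q_{n−1}(1+δ_n) | δ_1,…,δ_{n−1}) = Q_{n−1}(1+β_n)`.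
[cite: ElararEtAl2025, §3 Theorem 1, proof (inductive step)] -/
theorem integral_prod_insert [IsFiniteMeasure μ] (h : SRprErrorModel μ up upr δ β) (hup : 0 ≤ up)
    {s : Finset ℕ} {m : ℕ} (hlt : ∀ k ∈ s, k < m) :
    ∫ ω, ∏ k ∈ insert m s, (1 + δ k ω) ∂μ
      = ∫ ω, ∏ k ∈ s, (1 + δ k ω) ∂μ + ∫ ω, (∏ k ∈ s, (1 + δ k ω)) * β m ω ∂μ := by
  have hm : m ∉ s := fun hms => lt_irrefl _ (hlt m hms)
  have hsplit : ∀ ω, ∏ k ∈ insert m s, (1 + δ k ω)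
      = (∏ k ∈ s, (1 + δ k ω)) + (∏ k ∈ s, (1 + δ k ω)) * δ m ω := by
    intro ω; rw [Finset.prod_insert hm]; ring
  simp_rw [hsplit]
  have hQi := integrable_prod h s
  have hQδ : Integrable (fun ω => (∏ k ∈ s, (1 + δ k ω)) * δ m ω) μ :=
    hQi.mul_bdd (c := up) (h.measurable m).aestronglyMeasurable
      (ae_of_all _ (fun ω => by rw [Real.norm_eq_abs]; exact h.bounded m ω))
  rw [integral_add hQi hQδ]
  congr 1
  have key := h.integral_pastFn_mul_eq hup m (F := fun v => ∏ k ∈ s, (1 + v k)) ?_ ?_ ?_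
  · simpa using key
  · exact Finset.measurable_prod s (fun k _ => (measurable_pi_apply k).const_add 1)
  · intro v w hvw
    exact Finset.prod_congr rfl (fun k hk => by rw [hvw k (Set.mem_Iio.mpr (hlt k hk))])
  · refine ⟨(1 + up) ^ s.card, fun v hv => ?_⟩
    rw [Finset.abs_prod]
    calc ∏ k ∈ s, |1 + v k| ≤ ∏ _k ∈ s, (1 + up) :=
          Finset.prod_le_prod (fun _ _ => abs_nonneg _) (fun k _ =>
            (abs_add_le 1 (v k)).trans (by rw [abs_one]; linarith [hv k]))
      _ = (1 + up) ^ s.card := Finset.prod_const _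

/-- **THEOREM 1.** For random errors `δ_k` produced by a sequence of elementary operations under
`SR_{p,r}` (in the regime `u_p ≤ 1`) and every finite set `K` of their indices,
`E(∏_{k∈K}(1+δ_k)) ≤ (1+u_{p+r})^{|K|}` — by induction on `max K`:
`E(Q_n) = E(Q_{n−1}(1+β_n)) ≤ E(Q_{n−1})(1+u_{p+r})` (`Q_{n−1} ≥ 0` as `1+δ_k ≥ 1−u_p ≥ 0`).
[cite: ElararEtAl2025, §3 Theorem 1, eq. (3.4) and its proof] -/
theorem integral_prod_le [IsProbabilityMeasure μ] (h : SRprErrorModel μ up upr δ β)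
    (hup1 : up ≤ 1) (K : Finset ℕ) :
    ∫ ω, ∏ k ∈ K, (1 + δ k ω) ∂μ ≤ (1 + upr) ^ K.card := by
  have hup : 0 ≤ up := h.up_nonneg
  have hupr : 0 ≤ upr := h.upr_nonneg
  induction K using Finset.induction_on_max with
  | empty => simp
  | insert m s hlt ih =>
    have hm : m ∉ s := fun hms => lt_irrefl _ (hlt m hms)
    rw [h.integral_prod_insert hup hlt, Finset.card_insert_of_notMem hm, pow_succ]
    have hQi := integrable_prod h s
    have hQβ : Integrable (fun ω => (∏ k ∈ s, (1 + δ k ω)) * β m ω) μ :=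
      hQi.mul_bdd (c := upr) (h.biasMeasurable m).aestronglyMeasurable
        (ae_of_all _ (fun ω => by rw [Real.norm_eq_abs]; exact h.biasBounded m ω))
    have hle : ∫ ω, (∏ k ∈ s, (1 + δ k ω)) * β m ω ∂μ ≤ ∫ ω, upr * ∏ k ∈ s, (1 + δ k ω) ∂μ := by
      refine integral_mono hQβ (hQi.const_mul upr) (fun ω => ?_)
      have hQ := prod_nonneg_of_le_one h hup1 s ω
      have hb := (abs_le.mp (h.biasBounded m ω)).2
      calc (∏ k ∈ s, (1 + δ k ω)) * β m ω ≤ (∏ k ∈ s, (1 + δ k ω)) * upr :=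
            mul_le_mul_of_nonneg_left hb hQ
        _ = upr * ∏ k ∈ s, (1 + δ k ω) := mul_comm _ _
    rw [integral_const_mul] at hle
    have hI0 : 0 ≤ ∫ ω, ∏ k ∈ s, (1 + δ k ω) ∂μ :=
      integral_nonneg (fun ω => prod_nonneg_of_le_one h hup1 s ω)
    have h1 : 0 ≤ 1 + upr := by linarith
    nlinarith [mul_nonneg h1 (sub_nonneg.mpr ih)]

/-- **Theorem 1, the matching lower bound** (same induction, `β_m ≥ −u_{p+r}`): for `u_p ≤ 1` and
`u_{p+r} ≤ 1`, `(1−u_{p+r})^{|K|} ≤ E(∏_{k∈K}(1+δ_k))`. The source's use of Theorem 1 inside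
absolute values (proofs of Theorems 2 and 5, "by Theorem 3.1") needs this direction too.
[cite: ElararEtAl2025, §3 Theorem 1 proof; §4.1 Theorem 2 proof (step "by (thm:sr-mean)")] -/
theorem le_integral_prod [IsProbabilityMeasure μ] (h : SRprErrorModel μ up upr δ β)
    (hup1 : up ≤ 1) (hupr1 : upr ≤ 1) (K : Finset ℕ) :
    (1 - upr) ^ K.card ≤ ∫ ω, ∏ k ∈ K, (1 + δ k ω) ∂μ := by
  have hup : 0 ≤ up := h.up_nonneg
  induction K using Finset.induction_on_max with
  | empty => simp
  | insert m s hlt ih =>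
    have hm : m ∉ s := fun hms => lt_irrefl _ (hlt m hms)
    rw [h.integral_prod_insert hup hlt, Finset.card_insert_of_notMem hm, pow_succ]
    have hQi := integrable_prod h s
    have hQβ : Integrable (fun ω => (∏ k ∈ s, (1 + δ k ω)) * β m ω) μ :=
      hQi.mul_bdd (c := upr) (h.biasMeasurable m).aestronglyMeasurable
        (ae_of_all _ (fun ω => by rw [Real.norm_eq_abs]; exact h.biasBounded m ω))
    have hle : ∫ ω, (-upr) * ∏ k ∈ s, (1 + δ k ω) ∂μ ≤ ∫ ω, (∏ k ∈ s, (1 + δ k ω)) * β m ω ∂μ := by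
      refine integral_mono (hQi.const_mul (-upr)) hQβ (fun ω => ?_)
      have hQ := prod_nonneg_of_le_one h hup1 s ω
      have hb := (abs_le.mp (h.biasBounded m ω)).1
      calc (-upr) * ∏ k ∈ s, (1 + δ k ω) = (∏ k ∈ s, (1 + δ k ω)) * (-upr) := mul_comm _ _
        _ ≤ (∏ k ∈ s, (1 + δ k ω)) * β m ω := mul_le_mul_of_nonneg_left hb hQ
    rw [integral_const_mul] at hle
    have h1 : 0 ≤ 1 - upr := by linarith
    nlinarith [mul_nonneg h1 (sub_nonneg.mpr ih)]

/-- [folklore] `2 ≤ (1+u)^m + (1−u)^m` for `0 ≤ u ≤ 1` (the odd binomial terms cancel). -/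
private theorem two_le_pow_add_pow {u : ℝ} (hu0 : 0 ≤ u) (hu1 : u ≤ 1) (m : ℕ) :
    2 ≤ (1 + u) ^ m + (1 - u) ^ m := by
  induction m with
  | zero => norm_num
  | succ m ih =>
    have h1 : (1 - u) ^ m ≤ (1 + u) ^ m := pow_le_pow_left₀ (by linarith) (by linarith) m
    have hid : (1 + u) ^ (m + 1) + (1 - u) ^ (m + 1)
        = ((1 + u) ^ m + (1 - u) ^ m) + u * ((1 + u) ^ m - (1 - u) ^ m) := by ring
    rw [hid]
    nlinarith [mul_nonneg hu0 (sub_nonneg.mpr h1)]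

/-- **Theorem 1 in the form used by Theorems 2 and 5:** for `u_p ≤ 1`, `u_{p+r} ≤ 1` and every
finite set `K` of error indices, `|E(∏_{k∈K}(1+δ_k)) − 1| ≤ γ_{|K|}(u_{p+r})`, `γ_m(x) = (1+x)^m − 1`
(upper side: Theorem 1; lower side: `1 − (1−u)^m ≤ (1+u)^m − 1`).
[cite: ElararEtAl2025, §3 Theorem 1; §4.1 Theorem 2 proof ("by (thm:sr-mean)")] -/
theorem abs_integral_prod_sub_one_le [IsProbabilityMeasure μ] (h : SRprErrorModel μ up upr δ β)
    (hup1 : up ≤ 1) (hupr1 : upr ≤ 1) (K : Finset ℕ) :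
    |(∫ ω, ∏ k ∈ K, (1 + δ k ω) ∂μ) - 1| ≤ gammaFn K.card upr := by
  simp only [gammaFn]
  rw [abs_le]
  have h2 := two_le_pow_add_pow h.upr_nonneg hupr1 K.card
  constructor
  · linarith [h.le_integral_prod hup1 hupr1 K]
  · linarith [h.integral_prod_le hup1 K]

/-! ### The mechanism of §4: bias and tail of a recursive sum `Σ cᵢ ∏_{k∈Kᵢ}(1+δ_k)` -/

/-- [folklore] `γ_m(u) ≤ γ_N(u)` for `m ≤ N`, `0 ≤ u`. -/
private theorem gammaFn_mono_left {m N : ℕ} (hmN : m ≤ N) {u : ℝ} (hu : 0 ≤ u) :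
    gammaFn m u ≤ gammaFn N u := by
  simp only [gammaFn]
  linarith [pow_le_pow_right₀ (by linarith : (1:ℝ) ≤ 1 + u) hmN]

/-- **The bias of a recursive sum (the mechanism of Theorems 2 and 5):** for `u_p ≤ 1`,
`u_{p+r} ≤ 1` and index sets with `|Kᵢ| ≤ N`,
`|E(Σ_{i∈I} cᵢ ∏_{k∈Kᵢ}(1+δ_k)) − Σ cᵢ| ≤ (Σ|cᵢ|) γ_N(u_{p+r})` — linearity, the triangle
inequality, Theorem 1 termwise and `γ` increasing ("`γ_{n−max{i,2}+1} ≤ γ_{n−1}`").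
[cite: ElararEtAl2025, §4.1 Theorem 2 proof; §4.2 Theorem 5 proof] -/
theorem abs_integral_err_le [IsProbabilityMeasure μ] (h : SRprErrorModel μ up upr δ β)
    (hup1 : up ≤ 1) (hupr1 : upr ≤ 1) {ι : Type*} (I : Finset ι) (c : ι → ℝ)
    (K : ι → Finset ℕ) {N : ℕ} (hN : ∀ i ∈ I, (K i).card ≤ N) :
    |(∫ ω, ∑ i ∈ I, c i * ∏ k ∈ K i, (1 + δ k ω) ∂μ) - ∑ i ∈ I, c i|
      ≤ (∑ i ∈ I, |c i|) * gammaFn N upr := by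
  have hupr := h.upr_nonneg
  rw [integral_finsetSum _ (fun i _ => (integrable_prod h (K i)).const_mul (c i))]
  simp_rw [integral_const_mul]
  rw [← Finset.sum_sub_distrib, Finset.sum_mul]
  refine (Finset.abs_sum_le_sum_abs _ _).trans (Finset.sum_le_sum (fun i hi => ?_))
  rw [← mul_sub_one, abs_mul]
  exact mul_le_mul_of_nonneg_left ((h.abs_integral_prod_sub_one_le hup1 hupr1 (K i)).trans
    (gammaFn_mono_left (hN i hi) hupr)) (abs_nonneg _)

end SRprErrorModel

end General

/-! ### The probabilistic part: models on `Ω : Type` (the setting of the tree's martingale bounds) -/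

section Model

variable {Ω : Type} [MeasurableSpace Ω] {μ : Measure Ω}

/-- **Eq. (4.8), "`|ŷ − y| ≤ |M| + |A|`", as a transfer of tail bounds:** in the model, if the error of
the recursive sum under the mean-independent part `α = δ − β` alone exceeds `(Σ|cᵢ|)·R` with
probability at most `p`, then the error under `δ` exceeds `(Σ|cᵢ|)(R + γ_N(u_p+u_{p+r}) − γ_N(u_p))`
with probability at most `p` (`|Kᵢ| ≤ N`; Lemma 5, eqs. (3.8)–(3.9) and (4.10)) — the sequel's PROVED
`ElararEtAl2026.measure_err_gt_le_of_split` over the bridge `SRprErrorModel.limited`.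
[cite: ElararEtAl2025, §4.1 Theorem 3 proof, eqs. (4.8) and (4.10); Theorem 4 proof] -/
theorem SRprErrorModel.tail_le_of_split [IsProbabilityMeasure μ] {up upr : ℝ} {δ β : ℕ → Ω → ℝ}
    (h : SRprErrorModel μ up upr δ β) {σ : Type*} (I : Finset σ) (c : σ → ℝ) (K : σ → Finset ℕ)
    {N : ℕ} (hN : ∀ i ∈ I, (K i).card ≤ N) (R : ℝ) {p : ENNReal}
    (hα : μ {ω | (∑ i ∈ I, |c i|) * R
        < |(∑ i ∈ I, c i * ∏ k ∈ K i, (1 + (δ k ω - β k ω))) - ∑ i ∈ I, c i|} ≤ p) :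
    μ {ω | (∑ i ∈ I, |c i|) * (R + (gammaFn N (up + upr) - gammaFn N up))
        < |(∑ i ∈ I, c i * ∏ k ∈ K i, (1 + δ k ω)) - ∑ i ∈ I, c i|} ≤ p := by
  have key := ElararEtAl2026.measure_err_gt_le_of_split h.limited h.up_nonneg h.upr_nonneg I c K
    hN R hα
  simpa only [sub_add_cancel] using key

/-! ### §4.1 Recursive summation -/

/-- The computed recursive sum under `SR_{p,r}`, eq. (4.4): with `ŝ_1 = a_1`,
`ŝ_k = (ŝ_{k−1} + a_k)(1+δ_{k−1})` (`k = 2,…,n`), `ŷ = ŝ_n = Σ_{i=1}^{n} aᵢ ∏_{k=max(i,2)}^{n}(1+δ_{k−1})`.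
[cite: ElararEtAl2025, §4.1 eq. (4.4) (and the recurrence table before it)] -/
def sumComputed (n : ℕ) (a : ℕ → ℝ) (δ : ℕ → ℝ) : ℝ :=
  ∑ i ∈ Icc 1 n, a i * ∏ k ∈ Icc (max i 2) n, (1 + δ (k - 1))

/-- The set of error indices carried by the `i`-th term of (4.4): `Kᵢ = [max(i,2) − 1, n − 1]`
(the source's `𝓘ᵢ = ⟦max{i,2}, n⟧` shifted by the relabelling `δ_{k−1}`).
[cite: ElararEtAl2025, §4.1 eq. (4.4); Theorem 3 proof (`𝓘ᵢ`)] -/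
def sumIndex (n i : ℕ) : Finset ℕ := Icc (max i 2 - 1) (n - 1)

/-- **(4.4) is a recursive sum:** `ŷ = Σ_{i=1}^{n} aᵢ ∏_{k∈Kᵢ}(1+δ_k)`.
[cite: ElararEtAl2025, §4.1 eq. (4.4)] -/
theorem sumComputed_eq_sum_prod (n : ℕ) (a : ℕ → ℝ) (δ : ℕ → ℝ) :
    sumComputed n a δ = ∑ i ∈ Icc 1 n, a i * ∏ k ∈ sumIndex n i, (1 + δ k) := by
  unfold sumComputed sumIndex
  refine Finset.sum_congr rfl (fun i hi => ?_)
  have hn : 1 ≤ n := (Finset.mem_Icc.mp hi).1.trans (Finset.mem_Icc.mp hi).2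
  congr 1
  refine Finset.prod_nbij' (· - 1) (· + 1) ?_ ?_ ?_ ?_ (fun _ _ => rfl)
  · intro k hk
    have h2 := le_max_right i 2
    simp only [Finset.mem_Icc] at hk ⊢; omega
  · intro k hk
    have h2 := le_max_right i 2
    simp only [Finset.mem_Icc] at hk ⊢; omega
  · intro k hk
    have h2 := le_max_right i 2
    simp only [Finset.mem_Icc] at hk; omega
  · intro k _; omega

/-- `|Kᵢ| ≤ n − 1`. [cite: ElararEtAl2025, §4.1 Theorem 2 proof (`γ_{n−max{i,2}+1} ≤ γ_{n−1}`)] -/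
theorem card_sumIndex_le (n i : ℕ) : (sumIndex n i).card ≤ n - 1 := by
  have h2 := le_max_right i 2
  simp only [sumIndex, Nat.card_Icc]
  omega

/-- `Kᵢ ⊆ [1, n − 1]`: the martingale of Theorem 3 has the `n − 1` increments `α_1,…,α_{n−1}`.
[cite: ElararEtAl2025, §4.1 Theorem 3 proof] -/
theorem sumIndex_subset (n i : ℕ) : sumIndex n i ⊆ Icc 1 (n - 1) := by
  have h2 := le_max_right i 2
  exact Finset.Icc_subset_Icc (by omega) le_rfl

/-- Sanity: without rounding errors (4.4) is the exact sum. [cite: ElararEtAl2025, §4.1 eq. (4.1)] -/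
theorem sumComputed_exact (n : ℕ) (a : ℕ → ℝ) :
    sumComputed n a (fun _ => 0) = ∑ i ∈ Icc 1 n, a i := by
  simp [sumComputed]

/-- Sanity, `n = 2`: `ŷ = ŝ_2 = (a_1 + a_2)(1+δ_1)`. [cite: ElararEtAl2025, §4.1 (table)] -/
theorem sumComputed_two (a : ℕ → ℝ) (δ : ℕ → ℝ) :
    sumComputed 2 a δ = (a 1 + a 2) * (1 + δ 1) := by
  rw [sumComputed, show Icc 1 2 = {1, 2} from rfl, Finset.sum_pair (by norm_num)]
  norm_num
  ring

/-- **THEOREM 2 (bias of recursive summation under `SR_{p,r}`):** in the regime `u_p ≤ 1`,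
`u_{p+r} ≤ 1`, `|E(ŷ) − y| ≤ (Σ|aᵢ|) γ_{n−1}(u_{p+r})` (the source divides by `|y|`:
`|E(ŷ) − y|/|y| ≤ κ γ_{n−1}(u_{p+r})`). [cite: ElararEtAl2025, §4.1 Theorem 2, eq. (4.6)] -/
theorem sum_bias_le [IsProbabilityMeasure μ] {up upr : ℝ} {δ β : ℕ → Ω → ℝ}
    (h : SRprErrorModel μ up upr δ β) (hup1 : up ≤ 1) (hupr1 : upr ≤ 1) (n : ℕ) (a : ℕ → ℝ) :
    |(∫ ω, sumComputed n a (fun k => δ k ω) ∂μ) - ∑ i ∈ Icc 1 n, a i|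
      ≤ (∑ i ∈ Icc 1 n, |a i|) * gammaFn (n - 1) upr := by
  simp_rw [sumComputed_eq_sum_prod]
  exact h.abs_integral_err_le hup1 hupr1 (Icc 1 n) a (sumIndex n) (fun i _ => card_sumIndex_le n i)

/-- **THEOREM 3 (recursive summation under `SR_{p,r}`, martingales / Azuma–Hoeffding):** for every
`0 < λ`, with probability at least `1 − λ`,
`|ŷ − y| ≤ (Σ|aᵢ|)(√(u_p γ_{2(n−1)}(u_p)) √(ln(2/λ)) + γ_{n−1}(u_p+u_{p+r}) − γ_{n−1}(u_p))`
(the source divides by `|y|`). The martingale part `|M| ≤ (Σ|aᵢ|)√(u_pγ_{2(n−1)}(u_p))√(ln(2/λ))`,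
eq. (4.9), is the tree's PROVED `ElararEtAl2023.measure_err_gt_le_AH` for the mean-independent errors
`α_1,…,α_{n−1}`; the bias part is eq. (4.10). [cite: ElararEtAl2025, §4.1 Theorem 3, eq. (4.7)] -/
theorem sum_bound_AH [IsProbabilityMeasure μ] {up upr : ℝ} {δ β : ℕ → Ω → ℝ}
    (h : SRprErrorModel μ up upr δ β) (n : ℕ) (a : ℕ → ℝ) {lam : ℝ} (hlam : 0 < lam) :
    μ {ω | (∑ i ∈ Icc 1 n, |a i|)
            * (Real.sqrt (up * gammaFn (2 * (n - 1)) up) * Real.sqrt (Real.log (2 / lam))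
              + (gammaFn (n - 1) (up + upr) - gammaFn (n - 1) up))
        < |sumComputed n a (fun k => δ k ω) - ∑ i ∈ Icc 1 n, a i|} ≤ ENNReal.ofReal lam := by
  simp_rw [sumComputed_eq_sum_prod]
  exact h.tail_le_of_split (Icc 1 n) a (sumIndex n) (fun i _ => card_sumIndex_le n i) _
    (measure_err_gt_le_AH h.limited.meanIndep (Icc 1 n) a (sumIndex n)
      (fun i _ => sumIndex_subset n i) hlam)

/-- **THEOREM 4 (recursive summation under `SR_{p,r}`, variance / Bienaymé–Chebyshev):** for every
`0 < λ`, with probability at least `1 − λ`,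
`|ŷ − y| ≤ (Σ|aᵢ|)(√(γ_{n−1}(u_p²)/λ) + γ_{n−1}(u_p+u_{p+r}) − γ_{n−1}(u_p))` (the source divides by
`|y|`); the variance part is [esop23a]'s, the tree's PROVED `ElararEtAl2023.measure_err_gt_le_BC`.
[cite: ElararEtAl2025, §4.1 Theorem 4] -/
theorem sum_bound_BC [IsProbabilityMeasure μ] {up upr : ℝ} {δ β : ℕ → Ω → ℝ}
    (h : SRprErrorModel μ up upr δ β) (n : ℕ) (a : ℕ → ℝ) {lam : ℝ} (hlam : 0 < lam) :
    μ {ω | (∑ i ∈ Icc 1 n, |a i|)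
            * (Real.sqrt (gammaFn (n - 1) (up ^ 2) / lam)
              + (gammaFn (n - 1) (up + upr) - gammaFn (n - 1) up))
        < |sumComputed n a (fun k => δ k ω) - ∑ i ∈ Icc 1 n, a i|} ≤ ENNReal.ofReal lam := by
  have hγ : gammaFn (n - 1) (up ^ 2) = gammaSq (n - 1) up := rfl
  simp_rw [sumComputed_eq_sum_prod, hγ]
  exact h.tail_le_of_split (Icc 1 n) a (sumIndex n) (fun i _ => card_sumIndex_le n i) _
    (measure_err_gt_le_BC h.limited.meanIndep (Icc 1 n) a (sumIndex n)
      (fun i _ => card_sumIndex_le n i) hlam)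

/-! ### §4.2 Inner products: the martingale with the `γ_{2n}` radius -/

/-- `Kᵢ ⊆ [0, 2n)`: the `2n − 1` errors `δ_1,…,δ_{2n−1}` of the recurrence.
[cite: ElararEtAl2025, §4.2 (recurrence; "for `1 ≤ k ≤ 2n−1`")] -/
theorem ipIndex_subset_range {n i : ℕ} (hi : i ∈ Icc 1 n) : ipIndex n i ⊆ range (2 * n) := by
  intro x hx
  obtain ⟨hi1, hin⟩ := Finset.mem_Icc.mp hi
  simp only [ipIndex, Finset.mem_union, Finset.mem_image] at hx
  rw [Finset.mem_range]
  rcases hx with hx | ⟨k, hk, rfl⟩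
  · split_ifs at hx with h1
    · simp at hx
    · rw [Finset.mem_singleton] at hx; omega
  · have := Finset.mem_Icc.mp hk; omega

/-- [folklore] membership in `Kᵢ = {2i−2 (i ≠ 1)} ∪ {2k−1 : i ≤ k ≤ n}`. -/
private theorem mem_ipIndex {n i t : ℕ} : t ∈ ipIndex n i ↔
    (i ≠ 1 ∧ t = 2 * i - 2) ∨ ∃ k, i ≤ k ∧ k ≤ n ∧ t = 2 * k - 1 := by
  unfold ipIndex
  rw [Finset.mem_union, Finset.mem_image]
  constructor
  · rintro (h | ⟨k, hk, rfl⟩)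
    · split_ifs at h with h1
      · simp at h
      · exact Or.inl ⟨h1, Finset.mem_singleton.mp h⟩
    · exact Or.inr ⟨k, (Finset.mem_Icc.mp hk).1, (Finset.mem_Icc.mp hk).2, rfl⟩
  · rintro (⟨h1, rfl⟩ | ⟨k, hik, hkn, rfl⟩)
    · left; rw [if_neg h1, Finset.mem_singleton]
    · right; exact ⟨k, Finset.mem_Icc.mpr ⟨hik, hkn⟩, rfl⟩

/-- The sure bounds on the martingale increments of the inner product: at the addition time
`t = 2k−1` the coefficient of `δ_t` is `Σ_{i≤k} cᵢ ∏_{j∈Kᵢ, j<t}(1+δ_j)`, of modulus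
`≤ (Σ_{i≤k}|cᵢ|)(1+u)^{k−1}`; at the multiplication time `t = 2k−2 ≥ 2` it is `c_k`; at `t = 0` it
vanishes. [cite: ElararEtAl2025, §4.2 Theorem 6 proof ("the same structure as that of Theorem 3",
i.e. the increments `a_k` of Lemma 2 for the martingale `M`)] -/
noncomputable def ipBound (c : ℕ → ℝ) (u : ℝ) (t : ℕ) : ℝ :=
  if t % 2 = 1 then (∑ i ∈ Icc 1 (t / 2 + 1), |c i|) * (1 + u) ^ (t / 2)
  else if t = 0 then 0 else |c (t / 2 + 1)|

/-- [folklore] at an odd time `t = 2k−1`, the factors of `Kᵢ` before `t` number at most `k − 1`. -/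
private theorem card_ipIndex_filter_lt_le {n i t : ℕ} (hi1 : 1 ≤ i) (hodd : t % 2 = 1)
    (hik : i ≤ t / 2 + 1) : ((ipIndex n i).filter (· < t)).card ≤ t / 2 := by
  unfold ipIndex
  rw [Finset.filter_union, Finset.filter_image]
  refine (Finset.card_union_le _ _).trans ?_
  have hB : (((Icc i n).filter (fun k => 2 * k - 1 < t)).image (fun k => 2 * k - 1)).card
      ≤ t / 2 + 1 - i := by
    refine Finset.card_image_le.trans ?_
    calc ((Icc i n).filter (fun k => 2 * k - 1 < t)).card ≤ (Icc i (t / 2)).card :=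
          Finset.card_le_card (fun k hk => by
            simp only [Finset.mem_filter, Finset.mem_Icc] at hk ⊢; omega)
      _ = t / 2 + 1 - i := Nat.card_Icc _ _
  split_ifs with h1
  · rw [Finset.filter_empty, Finset.card_empty]; omega
  · have hA : (({2 * i - 2} : Finset ℕ).filter (· < t)).card ≤ 1 :=
      (Finset.card_filter_le _ _).trans (by simp)
    omega

variable {u : ℝ} {α : ℕ → Ω → ℝ}

/-- [folklore] `|∏_{k∈K}(1 + α_k)| ≤ (1 + u)^{|K|}` in the exact-SR model. -/
private theorem abs_prod_le' (hm : SRErrorModel μ u α) (K : Finset ℕ) (ω : Ω) :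
    |∏ k ∈ K, (1 + α k ω)| ≤ (1 + u) ^ K.card := by
  rw [Finset.abs_prod]
  calc ∏ k ∈ K, |1 + α k ω| ≤ ∏ _k ∈ K, (1 + u) :=
        Finset.prod_le_prod (fun _ _ => abs_nonneg _) (fun k _ =>
          (abs_add_le 1 (α k ω)).trans (by rw [abs_one]; linarith [hm.bounded k ω]))
    _ = (1 + u) ^ K.card := Finset.prod_const _

/-- **The inner-product increments are surely bounded: `|T_t(α)| ≤ A_t`** for the predictable
coefficients `T_t = ElararEtAl2023.ahCoef` of the error `Σ cᵢ∏_{Kᵢ}(1+α_k) − Σ cᵢ = Σ_t T_t α_t`.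
[cite: ElararEtAl2025, §4.2 Theorem 6 proof (via Theorem 3 proof: Lemma 2 for the martingale `M`)] -/
theorem abs_ahCoef_ip_le (hm : SRErrorModel μ u α) (n : ℕ) (c : ℕ → ℝ) (t : ℕ) (ω : Ω) :
    |ahCoef (Icc 1 n) c (ipIndex n) t (fun j => α j ω)| ≤ ipBound c u t := by
  have hu : 0 ≤ u := (abs_nonneg _).trans (hm.bounded 0 ω)
  have h1u : (1 : ℝ) ≤ 1 + u := by linarith
  unfold ahCoef ipBound
  by_cases hodd : t % 2 = 1
  · -- addition time `t = 2k − 1`, `k = t/2 + 1`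
    rw [if_pos hodd]
    have hfilt : (Icc 1 n).filter (fun i => t ∈ ipIndex n i) ⊆ Icc 1 (t / 2 + 1) := by
      intro i hi
      obtain ⟨hiI, hti⟩ := Finset.mem_filter.mp hi
      have hi1 := (Finset.mem_Icc.mp hiI).1
      rw [Finset.mem_Icc]
      rcases mem_ipIndex.mp hti with ⟨h1, ht⟩ | ⟨k, hik, _, ht⟩ <;> omega
    calc |∑ i ∈ (Icc 1 n).filter (fun i => t ∈ ipIndex n i),
            c i * ∏ j ∈ (ipIndex n i).filter (· < t), (1 + α j ω)|
        ≤ ∑ i ∈ (Icc 1 n).filter (fun i => t ∈ ipIndex n i), |c i| * (1 + u) ^ (t / 2) := by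
          refine (Finset.abs_sum_le_sum_abs _ _).trans (Finset.sum_le_sum (fun i hi => ?_))
          rw [abs_mul]
          refine mul_le_mul_of_nonneg_left ?_ (abs_nonneg _)
          obtain ⟨hiI, hti⟩ := Finset.mem_filter.mp hi
          have hi1 := (Finset.mem_Icc.mp hiI).1
          have hik : i ≤ t / 2 + 1 := (Finset.mem_Icc.mp (hfilt hi)).2
          calc |∏ j ∈ (ipIndex n i).filter (· < t), (1 + α j ω)|
              ≤ (1 + u) ^ ((ipIndex n i).filter (· < t)).card := abs_prod_le' hm _ ω
            _ ≤ (1 + u) ^ (t / 2) := pow_le_pow_right₀ h1u (card_ipIndex_filter_lt_le hi1 hodd hik)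
      _ ≤ ∑ i ∈ Icc 1 (t / 2 + 1), |c i| * (1 + u) ^ (t / 2) :=
          Finset.sum_le_sum_of_subset_of_nonneg hfilt
            (fun _ _ _ => mul_nonneg (abs_nonneg _) (pow_nonneg (by linarith) _))
      _ = (∑ i ∈ Icc 1 (t / 2 + 1), |c i|) * (1 + u) ^ (t / 2) := by rw [Finset.sum_mul]
  · rw [if_neg hodd]
    by_cases ht0 : t = 0
    · -- no error carries the index `0`
      subst ht0
      rw [if_pos rfl]
      have hempty : (Icc 1 n).filter (fun i => 0 ∈ ipIndex n i) = ∅ := by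
        refine Finset.filter_false_of_mem (fun i hi h0 => ?_)
        have hi1 := (Finset.mem_Icc.mp hi).1
        rcases mem_ipIndex.mp h0 with ⟨h1, ht⟩ | ⟨k, hik, _, ht⟩ <;> omega
      rw [hempty, Finset.sum_empty, abs_zero]
    · -- multiplication time `t = 2k − 2 ≥ 2`, `k = t/2 + 1`: only term `k`, empty partial product
      rw [if_neg ht0]
      have hfilt : (Icc 1 n).filter (fun i => t ∈ ipIndex n i) ⊆ {t / 2 + 1} := by
        intro i hi
        obtain ⟨hiI, hti⟩ := Finset.mem_filter.mp hi
        have hi1 := (Finset.mem_Icc.mp hiI).1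
        rw [Finset.mem_singleton]
        rcases mem_ipIndex.mp hti with ⟨h1, ht⟩ | ⟨k, hik, _, ht⟩ <;> omega
      have hprod : ∀ i ∈ (Icc 1 n).filter (fun i => t ∈ ipIndex n i),
          (ipIndex n i).filter (· < t) = ∅ := by
        intro i hi
        have hit : i = t / 2 + 1 := Finset.mem_singleton.mp (hfilt hi)
        refine Finset.filter_false_of_mem (fun j hj hjt => ?_)
        rcases mem_ipIndex.mp hj with ⟨h1, ht⟩ | ⟨k, hik, _, ht⟩ <;> omega
      calc |∑ i ∈ (Icc 1 n).filter (fun i => t ∈ ipIndex n i),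
              c i * ∏ j ∈ (ipIndex n i).filter (· < t), (1 + α j ω)|
          ≤ ∑ i ∈ (Icc 1 n).filter (fun i => t ∈ ipIndex n i),
              |c i * ∏ j ∈ (ipIndex n i).filter (· < t), (1 + α j ω)| :=
            Finset.abs_sum_le_sum_abs _ _
        _ = ∑ i ∈ (Icc 1 n).filter (fun i => t ∈ ipIndex n i), |c i| :=
            Finset.sum_congr rfl (fun i hi => by rw [hprod i hi, Finset.prod_empty, mul_one])
        _ ≤ ∑ i ∈ ({t / 2 + 1} : Finset ℕ), |c i| :=
            Finset.sum_le_sum_of_subset_of_nonneg hfilt (fun _ _ _ => abs_nonneg _)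
        _ = |c (t / 2 + 1)| := Finset.sum_singleton _ _

/-- **The sum of the squared increment bounds:** `Σ_{t<2n} (A_t u)² ≤ (Σ_{i≤n}|cᵢ|)² u² Σ_{l<n}(1+u)^{2l}`
(by induction on `n`: the two new times contribute `c_{n+1}²u²` and `(Σ_{i≤n+1}|cᵢ|)²(1+u)^{2n}u²`).
[cite: ElararEtAl2025, §4.2 Theorem 6 proof (via Theorem 3 proof, eq. (4.9))] -/
theorem sum_ipBound_sq_le (c : ℕ → ℝ) (u : ℝ) (n : ℕ) :
    ∑ t ∈ range (2 * n), (ipBound c u t * u) ^ 2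
      ≤ (∑ i ∈ Icc 1 n, |c i|) ^ 2 * u ^ 2 * ∑ l ∈ range n, ((1 + u) ^ 2) ^ l := by
  induction n with
  | zero => simp
  | succ n ih =>
    set S := ∑ i ∈ Icc 1 n, |c i| with hS
    set G := ∑ l ∈ range n, ((1 + u) ^ 2) ^ l with hG
    have hS0 : 0 ≤ S := Finset.sum_nonneg (fun _ _ => abs_nonneg _)
    have hG0 : 0 ≤ G := Finset.sum_nonneg (fun _ _ => pow_nonneg (sq_nonneg _) _)
    have hSsucc : ∑ i ∈ Icc 1 (n + 1), |c i| = S + |c (n + 1)| := by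
      rw [hS, Finset.sum_Icc_succ_top (by omega)]
    have hGsucc : ∑ l ∈ range (n + 1), ((1 + u) ^ 2) ^ l = G + ((1 + u) ^ 2) ^ n := by
      rw [hG, Finset.sum_range_succ]
    have h2 : 2 * (n + 1) = 2 * n + 1 + 1 := by ring
    rw [h2, Finset.sum_range_succ, Finset.sum_range_succ, hSsucc, hGsucc]
    -- the addition time `2n + 1`
    have hodd : ipBound c u (2 * n + 1) = (S + |c (n + 1)|) * (1 + u) ^ n := by
      unfold ipBound
      rw [if_pos (by omega), show (2 * n + 1) / 2 = n by omega, ← hSsucc]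
    have hodd' : (ipBound c u (2 * n + 1) * u) ^ 2
        = (S + |c (n + 1)|) ^ 2 * ((1 + u) ^ 2) ^ n * u ^ 2 := by
      rw [hodd, ← pow_mul, mul_comm 2 n, pow_mul]; ring
    -- the multiplication time `2n` (vanishing for `n = 0`)
    have heven : (ipBound c u (2 * n) * u) ^ 2 ≤ |c (n + 1)| ^ 2 * u ^ 2 * G := by
      by_cases hn : n = 0
      · subst hn
        have h0 : ipBound c u (2 * 0) = 0 := by simp [ipBound]
        rw [h0, zero_mul, sq, zero_mul]
        exact mul_nonneg (mul_nonneg (sq_nonneg _) (sq_nonneg _)) hG0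
      · have hval : ipBound c u (2 * n) = |c (n + 1)| := by
          unfold ipBound
          rw [if_neg (by omega), if_neg (by omega), show 2 * n / 2 + 1 = n + 1 by omega]
        have hG1 : 1 ≤ G := by
          rw [hG]
          calc (1 : ℝ) = ((1 + u) ^ 2) ^ 0 := (pow_zero _).symm
            _ ≤ ∑ l ∈ range n, ((1 + u) ^ 2) ^ l :=
                Finset.single_le_sum (fun l _ => pow_nonneg (sq_nonneg _) l)
                  (Finset.mem_range.mpr (Nat.pos_of_ne_zero hn))
        rw [hval]
        nlinarith [mul_nonneg (sq_nonneg (|c (n + 1)| * u)) (sub_nonneg.mpr hG1)]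
    have hint : 0 ≤ S * |c (n + 1)| * u ^ 2 * G :=
      mul_nonneg (mul_nonneg (mul_nonneg hS0 (abs_nonneg _)) (sq_nonneg _)) hG0
    nlinarith [ih, heven, hodd', hint]

/-- **`2 Σ_{t<2n} (A_t u)² ≤ (Σ|cᵢ|)² u γ_{2n}(u)`** (`2u² Σ_{l<n}(1+u)^{2l} ≤ uγ_{2n}(u) =
(2u²+u³) Σ_{l<n}(1+u)^{2l}`): the squared Azuma–Hoeffding radius of Theorem 6.
[cite: ElararEtAl2025, §4.2 Theorem 6 (the term `√(u_pγ_{2n}(u_p))`)] -/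
theorem two_mul_sum_ipBound_sq_le (c : ℕ → ℝ) {u : ℝ} (hu : 0 ≤ u) (n : ℕ) :
    2 * ∑ t ∈ range (2 * n), (ipBound c u t * u) ^ 2
      ≤ (∑ i ∈ Icc 1 n, |c i|) ^ 2 * (u * gammaFn (2 * n) u) := by
  have h1 := sum_ipBound_sq_le c u n
  have hgeom : (∑ l ∈ range n, ((1 + u) ^ 2) ^ l) * ((1 + u) ^ 2 - 1) = gammaFn (2 * n) u := by
    rw [geom_sum_mul, ← pow_mul, gammaFn]
  have hG : 0 ≤ ∑ l ∈ range n, ((1 + u) ^ 2) ^ l :=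
    Finset.sum_nonneg (fun _ _ => pow_nonneg (sq_nonneg _) _)
  rw [← hgeom]
  have hS : 0 ≤ (∑ i ∈ Icc 1 n, |c i|) ^ 2 := sq_nonneg _
  nlinarith [mul_nonneg (mul_nonneg hS (pow_nonneg hu 3)) hG]

/-- [folklore] `√(2σ²)√(ln(2/λ)) ≤ S√G√(ln(2/λ))` as soon as `2σ² ≤ S²G` and `S ≥ 0`. -/
private theorem azumaRadius_le_of_two_mul_le {σsq S G : ℝ} (lam : ℝ) (hS : 0 ≤ S)
    (h2 : 2 * σsq ≤ S ^ 2 * G) :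
    azumaRadius σsq lam ≤ S * (Real.sqrt G * Real.sqrt (Real.log (2 / lam))) := by
  have hL : 0 ≤ Real.sqrt (Real.log (2 / lam)) := Real.sqrt_nonneg _
  have hrad : azumaRadius σsq lam = Real.sqrt (2 * σsq) * Real.sqrt (Real.log (2 / lam)) := by
    rw [azumaRadius, Real.sqrt_mul (by norm_num : (0:ℝ) ≤ 2) (Real.log (2 / lam)),
      Real.sqrt_mul (by norm_num : (0:ℝ) ≤ 2) σsq]
    ring
  have henv : S * Real.sqrt G = Real.sqrt (S ^ 2 * G) := by
    rw [Real.sqrt_mul (sq_nonneg S), Real.sqrt_sq hS]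
  rw [hrad, ← mul_assoc, henv]
  exact mul_le_mul_of_nonneg_right (Real.sqrt_le_sqrt h2) hL

/-- **The martingale bound for the inner product with the `γ_{2n}` radius (Theorem 6 for exact SR,
`u_{p+r} = 0`):** in the mean-independent model, for `0 < λ`, with probability at least `1 − λ`,
`|Σ_{i=1}^{n} cᵢ∏_{k∈Kᵢ}(1+α_k) − Σcᵢ| ≤ (Σ|cᵢ|)√(uγ_{2n}(u))√(ln(2/λ))` — Azuma–Hoeffding
(`HallmanIpsen2023.azumaHoeffding`, Lemma 2 of the source) for the martingale transform
`Σ_{t<2n} T_t α_t` (`ElararEtAl2026.err_eq_transform_of_subset_range`) with the increment bounds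
`ipBound`. [cite: ElararEtAl2025, §4.2 Theorem 6 proof; §2.1 Lemma 2 (Azuma–Hoeffding)] -/
theorem ip_measure_err_gt_le_AH [IsProbabilityMeasure μ] (hm : SRErrorModel μ u α) (n : ℕ)
    (c : ℕ → ℝ) {lam : ℝ} (hlam : 0 < lam) :
    μ {ω | (∑ i ∈ Icc 1 n, |c i|)
            * (Real.sqrt (u * gammaFn (2 * n) u) * Real.sqrt (Real.log (2 / lam)))
        < |(∑ i ∈ Icc 1 n, c i * ∏ k ∈ ipIndex n i, (1 + α k ω)) - ∑ i ∈ Icc 1 n, c i|}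
      ≤ ENNReal.ofReal lam := by
  have hu : 0 ≤ u := u_nonneg hm
  have hS : 0 ≤ ∑ i ∈ Icc 1 n, |c i| := Finset.sum_nonneg (fun _ _ => abs_nonneg _)
  have hAH := azumaHoeffding hm (isPredictable_ahCoef (Icc 1 n) c (ipIndex n))
    (A := ipBound c u) (abs_ahCoef_ip_le hm n c) (2 * n) hlam
  refine le_trans (measure_mono (fun ω hω => ?_)) hAH
  simp only [Set.mem_setOf_eq] at hω ⊢
  rw [← ElararEtAl2026.err_eq_transform_of_subset_range (Icc 1 n) c (ipIndex n)
    (fun i hi => ipIndex_subset_range hi) α ω]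
  exact lt_of_le_of_lt
    (azumaRadius_le_of_two_mul_le lam hS (two_mul_sum_ipBound_sq_le c hu n)) hω

/-! ### §4.2 Inner products: Theorems 5–7 -/

/-- **THEOREM 5 (bias of the inner product under `SR_{p,r}`):** in the regime `u_p ≤ 1`,
`u_{p+r} ≤ 1`, `|E(ŷ) − y| ≤ (Σ|aᵢbᵢ|) γ_n(u_{p+r})` for the computed inner product
`ŷ = ElararEtAl2023.ipComputed n a b δ` of the §4.2 recurrence (the source divides by `|y|`).
[cite: ElararEtAl2025, §4.2 Theorem 5] -/
theorem ip_bias_le [IsProbabilityMeasure μ] {up upr : ℝ} {δ β : ℕ → Ω → ℝ}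
    (h : SRprErrorModel μ up upr δ β) (hup1 : up ≤ 1) (hupr1 : upr ≤ 1) (n : ℕ) (a b : ℕ → ℝ) :
    |(∫ ω, ipComputed n a b (fun k => δ k ω) ∂μ) - ∑ i ∈ Icc 1 n, a i * b i|
      ≤ (∑ i ∈ Icc 1 n, |a i * b i|) * gammaFn n upr := by
  simp_rw [ipComputed_eq_sum_prod]
  exact h.abs_integral_err_le hup1 hupr1 (Icc 1 n) (fun i => a i * b i) (ipIndex n)
    (fun i hi => card_ipIndex_le hi)

/-- **THEOREM 6 (inner product under `SR_{p,r}`, martingales / Azuma–Hoeffding):** for every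
`0 < λ`, with probability at least `1 − λ`,
`|ŷ − y| ≤ (Σ|aᵢbᵢ|)(√(u_p γ_{2n}(u_p)) √(ln(2/λ)) + γ_n(u_p+u_{p+r}) − γ_n(u_p))` (the source
divides by `|y|`). [cite: ElararEtAl2025, §4.2 Theorem 6] -/
theorem ip_bound_AH [IsProbabilityMeasure μ] {up upr : ℝ} {δ β : ℕ → Ω → ℝ}
    (h : SRprErrorModel μ up upr δ β) (n : ℕ) (a b : ℕ → ℝ) {lam : ℝ} (hlam : 0 < lam) :
    μ {ω | (∑ i ∈ Icc 1 n, |a i * b i|)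
            * (Real.sqrt (up * gammaFn (2 * n) up) * Real.sqrt (Real.log (2 / lam))
              + (gammaFn n (up + upr) - gammaFn n up))
        < |ipComputed n a b (fun k => δ k ω) - ∑ i ∈ Icc 1 n, a i * b i|}
      ≤ ENNReal.ofReal lam := by
  simp_rw [ipComputed_eq_sum_prod]
  exact h.tail_le_of_split (Icc 1 n) (fun i => a i * b i) (ipIndex n)
    (fun i hi => card_ipIndex_le hi) _
    (ip_measure_err_gt_le_AH h.limited.meanIndep n (fun i => a i * b i) hlam)

/-- **THEOREM 7 (inner product under `SR_{p,r}`, variance / Bienaymé–Chebyshev):** for every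
`0 < λ`, with probability at least `1 − λ`,
`|ŷ − y| ≤ (Σ|aᵢbᵢ|)(√(γ_n(u_p²)/λ) + γ_n(u_p+u_{p+r}) − γ_n(u_p))` (the source divides by `|y|`).
[cite: ElararEtAl2025, §4.2 Theorem 7] -/
theorem ip_bound_BC [IsProbabilityMeasure μ] {up upr : ℝ} {δ β : ℕ → Ω → ℝ}
    (h : SRprErrorModel μ up upr δ β) (n : ℕ) (a b : ℕ → ℝ) {lam : ℝ} (hlam : 0 < lam) :
    μ {ω | (∑ i ∈ Icc 1 n, |a i * b i|)
            * (Real.sqrt (gammaFn n (up ^ 2) / lam) + (gammaFn n (up + upr) - gammaFn n up))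
        < |ipComputed n a b (fun k => δ k ω) - ∑ i ∈ Icc 1 n, a i * b i|}
      ≤ ENNReal.ofReal lam := by
  have hγ : gammaFn n (up ^ 2) = gammaSq n up := rfl
  simp_rw [ipComputed_eq_sum_prod, hγ]
  exact h.tail_le_of_split (Icc 1 n) (fun i => a i * b i) (ipIndex n)
    (fun i hi => card_ipIndex_le hi) _
    (measure_err_gt_le_BC h.limited.meanIndep (Icc 1 n) (fun i => a i * b i) (ipIndex n)
      (fun i hi => card_ipIndex_le hi) hlam)

end Model

end Literature.ComputerArithmetic.ElararEtAl2025
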